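import Summits.ValiantsHypothesis.ValiantsHypothesis.Theses.ValuativeGCT
import Literature.NumberTheory.DiophantineGeometry.SchurWeylPlethysmKroneckerBoundProofs
import Literature.NumberTheory.DiophantineGeometry.SchurWeylPlethysmOrbitWeightsProofs
import Literature.Computability.AlgebraicComplexity.MultiplicityObstructionsProofs
import Literature.Computability.AlgebraicComplexity.PlethysmLifting
import Literature.Computability.AlgebraicComplexity.OrbitCoordinateRingProofs

/-!
# Crux triage r1, triager 3 (gen 2) — scratch checks for crux stmt-ValiantsHypothesis-12625
(`ValuativeGCT.ValuativeBound`).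

Contents: (1) `#check` of every tree / Mathlib declaration the seven idea
cards lean on; (2) the cards' `First lemma:` statements, typed verbatim from the card bodies
(elaboration check); (3) kernel-checked pieces of the common lever: the glue
`range hwToPoly ≤ T → ValuativeBound`, the Borel-clause SIGN (card hwtopoly-density-transport's
cheapest falsifier) as a pointwise and as a polynomial identity, the Stab clause for ALL matrices
`M` with `M • det = det`, the semisimple lift (card semisimple-lift-exact-rank's first lemma) and
the exact-rank formula, and OrbitMapKernel (stmt-12627) from the tree lemma; (6) the common line
end to end: `valuativeBound_of_coeffVanishingOrder : CoeffVanishingOrder → ValuativeBound`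
(the crux modulo support item stmt-12628), sorry-free, standard axioms.
-/

open MvPolynomial
open Literature.NumberTheory.DiophantineGeometry Literature.Computability.AlgebraicComplexity

namespace TriageR1K3

noncomputable section

/-! ## (0) probe — omitted in the published copy (see `valuativeBound_of_coeffVanishingOrder`, whose
conclusion is the crux decl, for elaboration of the crux). -/

/-! ## (1) Leans-on names -/

#check @orbitCoordToPoly
#check @orbitCoordToPoly_mk
#check @orbitCoordToPoly_injective
#check @eval_orbitCoordToPoly_mk
#check @hwToPoly
#check @hwToPoly_apply
#check @hwToPoly_injective
#check @eval_orbitCoordToPoly_mul_left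
#check @eval_orbitCoordToPoly_mul_right
#check @isHomogeneous_orbitCoordToPoly
#check @size_toMatIdx_dualOfPartition
#check @weightChar_inv
#check @sub_mem_of_mk_mem_highestWeightSpace
#check @finrank_highestWeightSpace_orbitCoordRep_le
#check @genericOrbitMap
#check @eval_genericOrbitMap
#check @Polynomial.eval_aeval_genericOrbitMap
#check @orbitVanishingIdeal_eq_ker_genericOrbitMap
#check @aeval_formCoeff_coordSubst
#check @linSubst_mul
#check @Literature.Computability.AlgebraicComplexity.linSubst_X
#check @sum_filter_monWeight_mem_orbitVanishingIdeal
#check @sum_aeval_monomial_filter_monWeight_eq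
#check @exists_lift_of_mem_highestWeightSpace_orbitCoordRep
#check @size_monWeight
#check @isSemisimpleRepresentation_coordRep
#check @isSemisimpleRepresentation_orbitCoordRep
#check @map_highestWeightSpace_eq_of_surjective
#check @mkₐ_comp_coordRep
#check @isHomogeneous_of_mem_highestWeightSpace
#check @isHomogeneous_of_eval_smul_eq
#check @finiteDimensional_highestWeightSpace_coordRep_holds
#check @eval_coeff_genericLinSubst
#check @endOrbit_subset_orbitClosure_holds
#check @MvPolynomial.eq_of_eval_eq_on_gl
#check @MvPolynomial.funext
#check @MvPolynomial.mem_map_C_iff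
#check @Ideal.map_pow
#check @Ideal.pow_right_mono
#check @MvPolynomial.mem_pow_idealOfVars_iff
#check @Matrix.Pivot.exists_list_transvec_mul_diagonal_mul_list_transvec
#check @Matrix.det_updateCol_smul
#check @LinearMap.finrank_range_add_finrank_ker
#check @LinearMap.finrank_range_of_inj
#check @Submodule.finrank_mono
#check @Literature.Computability.AlgebraicComplexity.finite_homogeneousSubmodule
#check @MvPolynomial.homogeneousSubmodule_fg
#check @Submodule.projectionOnto
#check @Matrix.det_apply'

/-! ## (3) kernel-checked pieces of the common lever -/

/-- Evaluating an `aeval`-substitution by polynomials = evaluating at the evaluated substitution. -/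
theorem eval_aeval_poly {σ' τ : Type*} (A : τ → ℂ) (h : σ' → MvPolynomial τ ℂ) (φ : MvPolynomial σ' ℂ) :
    eval A (aeval h φ) = eval (fun i => eval A (h i)) φ := by
  rw [aeval_eq_bind₁]
  exact eval₂Hom_bind₁ _ _ _ _

/-- GLUE (shared by the three hwToPoly cards and the semisimple card): an inclusion of the range
of the tree's injection `hwToPoly` into any `T` sitting inside a homogeneous piece bounds the
orbit multiplicity by `finrank T` (no junk: `T` is finite-dimensional). -/
theorem orbitMultiplicity_le_finrank_of_range_le {m : ℕ} (χ : Weight (MatIdx m)) (n : ℕ)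
    (T : Submodule ℂ (MvPolynomial (MatIdx m × MatIdx m) ℂ))
    (hT : T ≤ homogeneousSubmodule (MatIdx m × MatIdx m) ℂ n)
    (hrange : LinearMap.range (hwToPoly (detFormLex ℂ m) m χ) ≤ T) :
    orbitMultiplicity ℂ (detFormLex ℂ m) m χ ≤ Module.finrank ℂ T := by
  haveI : Module.Finite ℂ (homogeneousSubmodule (MatIdx m × MatIdx m) ℂ n) :=
    Literature.Computability.AlgebraicComplexity.finite_homogeneousSubmodule _ _ n
  haveI : Module.Finite ℂ T := Submodule.finiteDimensional_of_le hT
  calc orbitMultiplicity ℂ (detFormLex ℂ m) m χ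
        = Module.finrank ℂ (highestWeightSpace (orbitCoordRep (detFormLex ℂ m) m) χ) := rfl
    _ = Module.finrank ℂ (LinearMap.range (hwToPoly (detFormLex ℂ m) m χ)) :=
        (LinearMap.finrank_range_of_inj (hwToPoly_injective _ _ _)).symm
    _ ≤ Module.finrank ℂ T := Submodule.finrank_mono hrange

/-- `RangeLeTruncation`: the crux body with its conclusion replaced by `range hwToPoly ≤ T`
(T verbatim from the route file). -/
def RangeLeTruncation : Prop :=
  ∀ (m : ℕ) [NeZero m] (U : Submodule ℂ (Literature.NumberTheory.DiophantineGeometry.MatIdx m → ℂ)) (r : ℕ), (∀ u ∈ U, (Matrix.of fun a b : Fin m => u (toLex (a, b))).rank ≤ r) → ∀ (δ : ℕ) (lam : Nat.Partition (m * δ)), lam.parts.card ≤ m * m → let χ : Literature.NumberTheory.DiophantineGeometry.Weight (Literature.NumberTheory.DiophantineGeometry.MatIdx m) := (Literature.NumberTheory.DiophantineGeometry.Weight.dualOfPartition (m * m) lam).toMatIdx; let T : Submodule ℂ (MvPolynomial (Literature.NumberTheory.DiophantineGeometry.MatIdx m × Literature.NumberTheory.DiophantineGeometry.MatIdx m) ℂ)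 := MvPolynomial.homogeneousSubmodule (Literature.NumberTheory.DiophantineGeometry.MatIdx m × Literature.NumberTheory.DiophantineGeometry.MatIdx m) ℂ (m * δ) ⊓ ((MvPolynomial.vanishingIdeal ℂ {p : Literature.NumberTheory.DiophantineGeometry.MatIdx m × Literature.NumberTheory.DiophantineGeometry.MatIdx m → ℂ | ∀ j : Literature.NumberTheory.DiophantineGeometry.MatIdx m, (fun i => p (j, i)) ∈ U}) ^ (δ * (m - r))).restrictScalars ℂ ⊓ (⨅ (M : Matrix (Literature.NumberTheory.DiophantineGeometry.MatIdx m) (Literature.NumberTheory.DiophantineGeometry.MatIdx m) ℂ) (_ : Literature.Computability.AlgebraicComplexity.linSubst (Literature.NumberTheory.DiophantineGeometry.MatIdx m) ℂ M (Literature.NumberTheory.DiophantineGeometry.detFormLex ℂ m) = Literature.NumberTheory.DiophantineGeometry.detFormLex ℂ m), LinearMap.ker ((MvPolynomial.aeval (R := ℂ) fun p : Literature.NumberTheory.DiophantineGeometry.MatIdx m × Literature.NumberTheory.DiophantineGeometry.MatIdx m => ∑ l : Literature.NumberTheory.DiophantineGeometry.MatIdx m, M l p.2 • MvPolynomial.X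 (p.1, l)).toLinearMap - LinearMap.id (R := ℂ) (M := MvPolynomial (Literature.NumberTheory.DiophantineGeometry.MatIdx m × Literature.NumberTheory.DiophantineGeometry.MatIdx m) ℂ))) ⊓ (⨅ (g : Matrix.GeneralLinearGroup (Literature.NumberTheory.DiophantineGeometry.MatIdx m) ℂ) (_ : Literature.NumberTheory.DiophantineGeometry.IsUpperTriangular g), LinearMap.ker ((MvPolynomial.aeval (R := ℂ) fun p : Literature.NumberTheory.DiophantineGeometry.MatIdx m × Literature.NumberTheory.DiophantineGeometry.MatIdx m => ∑ l : Literature.NumberTheory.DiophantineGeometry.MatIdx m, ((g⁻¹ : Matrix.GeneralLinearGroup (Literature.NumberTheory.DiophantineGeometry.MatIdx m) ℂ) : Matrix (Literature.NumberTheory.DiophantineGeometry.MatIdx m) (Literature.NumberTheory.DiophantineGeometry.MatIdx m) ℂ) p.1 l • MvPolynomial.X (l, p.2)).toLinearMap - Literature.NumberTheory.DiophantineGeometry.weightChar χ g • LinearMap.id (R := ℂ) (M := MvPolynomial (Literature.NumberTheory.DiophantineGeometry.MatIdx m × Literature.NumberTheory.DiophantineGeometry.MatIdx m) ℂ))); LinearMap.range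 (Literature.NumberTheory.DiophantineGeometry.hwToPoly (Literature.NumberTheory.DiophantineGeometry.detFormLex ℂ m) m χ) ≤ T

/-- The reduction every Φ-injection card uses: `RangeLeTruncation → ValuativeBound`. -/
theorem valuativeBound_of_rangeLeTruncation (h : RangeLeTruncation) :
    Summit.ValiantsHypothesis.ValiantsHypothesis.Theses.ValuativeGCT.ValuativeBound := by
  intro m _ U r hU δ lam hlam
  have h' := h m U r hU δ lam hlam
  dsimp only at h' ⊢
  exact orbitMultiplicity_le_finrank_of_range_le _ (m * δ) _
    (fun _ hx => hx.1.1.1) h'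

/-- BOREL SIGN (card hwtopoly-density-transport, cheapest falsifier): from the tree lemma
`eval_orbitCoordToPoly_mul_left` alone, `P(g⁻¹ g') = weightChar χ g · P(g')` — the character, not
its inverse, exactly as T's B-clause is typed. -/
theorem borel_sign {m : ℕ} {F : MvPolynomial (DegIdx (MatIdx m) m) ℂ} {χ : Weight (MatIdx m)}
    (hx : Ideal.Quotient.mk (orbitVanishingIdeal (detFormLex ℂ m) m) F ∈
      highestWeightSpace (orbitCoordRep (detFormLex ℂ m) m) χ)
    {g : GL (MatIdx m) ℂ} (hg : IsUpperTriangular g) (g' : GL (MatIdx m) ℂ) :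
    eval (fun ij : MatIdx m × MatIdx m =>
        (((g⁻¹ : GL (MatIdx m) ℂ) : Matrix (MatIdx m) (MatIdx m) ℂ) * (g' : Matrix (MatIdx m) (MatIdx m) ℂ)) ij.1 ij.2)
        (orbitCoordToPoly (detFormLex ℂ m) m (Ideal.Quotient.mk (orbitVanishingIdeal (detFormLex ℂ m) m) F)) =
      weightChar χ g *
        eval (fun ij : MatIdx m × MatIdx m => (g' : Matrix (MatIdx m) (MatIdx m) ℂ) ij.1 ij.2)
          (orbitCoordToPoly (detFormLex ℂ m) m (Ideal.Quotient.mk (orbitVanishingIdeal (detFormLex ℂ m) m) F)) := by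
  have h := eval_orbitCoordToPoly_mul_left (detFormLex ℂ m) m hx ((borelSubgroup _ _).inv_mem hg) g'
  rwa [weightChar_inv χ hg, inv_inv] at h

/-- T's Borel clause as a POLYNOMIAL identity (card hwtopoly-density-transport `BorelClausePoly`,
card hwtopoly-range-truncation `BorelConjunct`): GL-density (`MvPolynomial.eq_of_eval_eq_on_gl`)
upgrades `borel_sign`. -/
theorem borel_clause_poly {m : ℕ} {F : MvPolynomial (DegIdx (MatIdx m) m) ℂ} {χ : Weight (MatIdx m)}
    (hx : Ideal.Quotient.mk (orbitVanishingIdeal (detFormLex ℂ m) m) F ∈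
      highestWeightSpace (orbitCoordRep (detFormLex ℂ m) m) χ)
    {g : GL (MatIdx m) ℂ} (hg : IsUpperTriangular g) :
    aeval (R := ℂ) (fun p : MatIdx m × MatIdx m =>
        ∑ l : MatIdx m, ((g⁻¹ : GL (MatIdx m) ℂ) : Matrix (MatIdx m) (MatIdx m) ℂ) p.1 l • X (l, p.2))
        (orbitCoordToPoly (detFormLex ℂ m) m (Ideal.Quotient.mk (orbitVanishingIdeal (detFormLex ℂ m) m) F)) =
      weightChar χ g •
        orbitCoordToPoly (detFormLex ℂ m) m (Ideal.Quotient.mk (orbitVanishingIdeal (detFormLex ℂ m) m) F) := by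
  apply MvPolynomial.eq_of_eval_eq_on_gl
  intro g'
  have hfun : (fun i : MatIdx m × MatIdx m =>
      eval (fun ij : MatIdx m × MatIdx m => (g' : Matrix (MatIdx m) (MatIdx m) ℂ) ij.1 ij.2)
        (∑ l : MatIdx m, ((g⁻¹ : GL (MatIdx m) ℂ) : Matrix (MatIdx m) (MatIdx m) ℂ) i.1 l • X (l, i.2))) =
      fun ij => (((g⁻¹ : GL (MatIdx m) ℂ) : Matrix (MatIdx m) (MatIdx m) ℂ) *
        (g' : Matrix (MatIdx m) (MatIdx m) ℂ)) ij.1 ij.2 := by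
    funext ij
    simp [Matrix.mul_apply, smul_eval]
  rw [smul_eval, ← borel_sign hx hg g', eval_aeval_poly, hfun]

/-- T's stabiliser clause for EVERY matrix `M` with `M • det = det` (invertible or not), at the
level of `genericOrbitMap` (all hwToPoly cards; card semisimple-lift-exact-rank (5)). -/
theorem stab_clause_poly {m : ℕ} (F : MvPolynomial (DegIdx (MatIdx m) m) ℂ)
    {M : Matrix (MatIdx m) (MatIdx m) ℂ} (hM : linSubst (MatIdx m) ℂ M (detFormLex ℂ m) = detFormLex ℂ m) :
    aeval (R := ℂ) (fun p : MatIdx m × MatIdx m => ∑ l : MatIdx m, M l p.2 • X (p.1, l))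
        (genericOrbitMap (detFormLex ℂ m) m F) = genericOrbitMap (detFormLex ℂ m) m F := by
  apply MvPolynomial.funext
  intro A
  rw [eval_aeval_poly]
  have hA : (fun ij : MatIdx m × MatIdx m => eval A (∑ l : MatIdx m, M l ij.2 • X (ij.1, l))) =
      fun ij => ((Matrix.of fun i j => A (i, j)) * M) ij.1 ij.2 := by
    funext ij
    simp [Matrix.mul_apply, smul_eval, mul_comm]
  rw [hA, eval_genericOrbitMap, linSubst_mul, AlgHom.comp_apply, hM,
    ← eval_genericOrbitMap]
  rfl

/-- SEMISIMPLE LIFT (card semisimple-lift-exact-rank, first lemma `HighestWeightClassLifts`):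
highest-weight CLASSES of `ℂ[Δ_m[f]]` are classes of honest highest-weight VECTORS of `ℂ[Sym^m]`. -/
theorem highestWeightClassLifts {σ : Type} [Fintype σ] [LinearOrder σ] (f : MvPolynomial σ ℂ)
    (m : ℕ) (χ : Weight σ) :
    (highestWeightSpace (coordRep σ ℂ m) χ).map
        (Ideal.Quotient.mkₐ ℂ (orbitVanishingIdeal f m)).toLinearMap =
      highestWeightSpace (orbitCoordRep f m) χ := by
  let π : (coordRep σ ℂ m).IntertwiningMap (orbitCoordRep f m) :=
    ⟨(Ideal.Quotient.mkₐ ℂ (orbitVanishingIdeal f m)).toLinearMap, fun _ => LinearMap.ext fun _ => rfl⟩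
  exact map_highestWeightSpace_eq_of_surjective π (Ideal.Quotient.mkₐ_surjective ℂ _)
    (isSemisimpleRepresentation_coordRep m) χ

/-- EXACT RANK (card semisimple-lift-exact-rank, Transfer `ExactRankFormula`):
`range hwToPoly = genericOrbitMap (HWV_χ(ℂ[Sym^m]))`. -/
theorem range_hwToPoly_eq {σ : Type} [Fintype σ] [LinearOrder σ] (f : MvPolynomial σ ℂ)
    (m : ℕ) (χ : Weight σ) :
    LinearMap.range (hwToPoly f m χ) =
      (highestWeightSpace (coordRep σ ℂ m) χ).map (genericOrbitMap f m).toLinearMap := by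
  ext P
  constructor
  · rintro ⟨x, rfl⟩
    have hx : (x : OrbitCoordRing f m) ∈ (highestWeightSpace (coordRep σ ℂ m) χ).map
        (Ideal.Quotient.mkₐ ℂ (orbitVanishingIdeal f m)).toLinearMap := by
      rw [highestWeightClassLifts]
      exact x.2
    obtain ⟨F, hF, hFx⟩ := hx
    refine ⟨F, hF, ?_⟩
    rw [hwToPoly_apply, ← hFx]
    exact (orbitCoordToPoly_mk f m F).symm
  · rintro ⟨F, hF, rfl⟩
    have hx : Ideal.Quotient.mk (orbitVanishingIdeal f m) F ∈ highestWeightSpace (orbitCoordRep f m) χ := by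
      rw [← highestWeightClassLifts]
      exact ⟨F, hF, rfl⟩
    exact ⟨⟨_, hx⟩, by rw [hwToPoly_apply]; exact orbitCoordToPoly_mk f m F⟩

/-- OrbitMapKernel (support item stmt-12627) is the tree lemma up to unfolding. -/
theorem orbitMapKernel_holds : Summit.ValiantsHypothesis.ValiantsHypothesis.Theses.ValuativeGCT.OrbitMapKernel := by
  intro m F
  rw [orbitVanishingIdeal_eq_ker_genericOrbitMap, RingHom.mem_ker]
  rfl


/-! ## (1b) degree clause T1 -/

/-- T1 (all hwToPoly cards): the image of a weight-`λ*` class is homogeneous of degree `m·δ`;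
this is exactly where the crux's guard `lam.parts.card ≤ m*m` is consumed. -/
theorem degree_clause {m δ : ℕ} (lam : Nat.Partition (m * δ)) (hlam : lam.parts.card ≤ m * m)
    {F : MvPolynomial (DegIdx (MatIdx m) m) ℂ}
    (hx : Ideal.Quotient.mk (orbitVanishingIdeal (detFormLex ℂ m) m) F ∈
      highestWeightSpace (orbitCoordRep (detFormLex ℂ m) m)
        ((Weight.dualOfPartition (m * m) lam).toMatIdx : Weight (MatIdx m))) :
    orbitCoordToPoly (detFormLex ℂ m) m (Ideal.Quotient.mk (orbitVanishingIdeal (detFormLex ℂ m) m) F) ∈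
      homogeneousSubmodule (MatIdx m × MatIdx m) ℂ (m * δ) :=
  (mem_homogeneousSubmodule _ _).mpr
    (isHomogeneous_orbitCoordToPoly _ m hx (size_toMatIdx_dualOfPartition m lam hlam))

/-! ## (2) The cards' `First lemma:` statements, typed verbatim from the card bodies -/

namespace FirstLemmas

/-- card hwtopoly-density-transport — `BorelClausePoly` (verbatim). -/
def BorelClausePoly : Prop :=
    ∀ (m : ℕ) (χ : Weight (MatIdx m)) (x : highestWeightSpace (orbitCoordRep (detFormLex ℂ m) m) χ)
      (g : GL (MatIdx m) ℂ), IsUpperTriangular g →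
      aeval (R := ℂ) (fun p : MatIdx m × MatIdx m =>
          ∑ l, ((g⁻¹ : GL (MatIdx m) ℂ) : Matrix (MatIdx m) (MatIdx m) ℂ) p.1 l • X (l, p.2))
        (orbitCoordToPoly (detFormLex ℂ m) m (x : OrbitCoordRing (detFormLex ℂ m) m)) =
      weightChar χ g • orbitCoordToPoly (detFormLex ℂ m) m (x : OrbitCoordRing (detFormLex ℂ m) m)

/-- … and it HOLDS (from `borel_clause_poly`). -/
theorem borelClausePoly_holds : BorelClausePoly := by
  intro m χ x g hg
  obtain ⟨F, hF⟩ := Ideal.Quotient.mk_surjective (x : OrbitCoordRing (detFormLex ℂ m) m)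
  have hx : Ideal.Quotient.mk (orbitVanishingIdeal (detFormLex ℂ m) m) F ∈
      highestWeightSpace (orbitCoordRep (detFormLex ℂ m) m) χ := by
    rw [hF]; exact x.2
  rw [← hF]
  exact borel_clause_poly hx hg

/-- card det-transversal-order-transport — `KernelColumnDivisibility` (verbatim). -/
def KernelColumnDivisibility : Prop :=
    ∀ (m r : ℕ) (u y : Matrix (Fin m) (Fin m) ℂ), u.rank ≤ r →
      (Polynomial.X : Polynomial ℂ) ^ (m - r) ∣
        (u.map (Polynomial.C : ℂ →+* Polynomial ℂ) + (Polynomial.X : Polynomial ℂ) • y.map Polynomial.C).det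

/-- card det-transversal-order-transport — Transfer `DetTransversalOrder` (C⁺, verbatim up to
binder syntax). -/
def DetTransversalOrder : Prop :=
  ∀ (m : ℕ) (U : Submodule ℂ (MatIdx m → ℂ)) (r : ℕ),
    (∀ u ∈ U, (Matrix.of fun a b : Fin m => u (toLex (a, b))).rank ≤ r) →
    detFormLex ℂ m ∈ (Ideal.span {ℓ : MvPolynomial (MatIdx m) ℂ |
      ℓ ∈ homogeneousSubmodule (MatIdx m) ℂ 1 ∧ ∀ u ∈ U, eval u ℓ = 0}) ^ (m - r)

/-- card hwtopoly-range-in-truncation — `GeneralTransport` (C⁺, verbatim). -/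
def GeneralTransport : Prop :=
  ∀ {σ : Type} [Fintype σ] [LinearOrder σ] (f : MvPolynomial σ ℂ) (m : ℕ), m ≠ 0 →
    ∀ (J : Ideal (MvPolynomial (σ × σ) ℂ)), (∀ d : DegIdx σ m, genericOrbitMap f m (MvPolynomial.X d) ∈ J) →
    ∀ (δ : ℕ) (χ : Weight σ), χ.size = -((m * δ : ℕ) : ℤ) →
      LinearMap.range (hwToPoly f m χ) ≤
        MvPolynomial.homogeneousSubmodule (σ × σ) ℂ (m * δ) ⊓ (J ^ δ).restrictScalars ℂ ⊓
          (⨅ (M : Matrix σ σ ℂ) (_ : linSubst σ ℂ M f = f),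
            LinearMap.ker ((MvPolynomial.aeval (R := ℂ) fun p : σ × σ =>
              ∑ l : σ, M l p.2 • MvPolynomial.X (p.1, l)).toLinearMap -
              LinearMap.id (R := ℂ) (M := MvPolynomial (σ × σ) ℂ))) ⊓
          (⨅ (g : Matrix.GeneralLinearGroup σ ℂ) (_ : IsUpperTriangular g),
            LinearMap.ker ((MvPolynomial.aeval (R := ℂ) fun p : σ × σ =>
              ∑ l : σ, ((g⁻¹ : Matrix.GeneralLinearGroup σ ℂ) : Matrix σ σ ℂ) p.1 l •
                MvPolynomial.X (l, p.2)).toLinearMap -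
              weightChar χ g • LinearMap.id (R := ℂ) (M := MvPolynomial (σ × σ) ℂ)))

/-- card semisimple-lift-exact-rank — `HighestWeightClassLifts` (verbatim); PROVED above as
`TriageR1K3.highestWeightClassLifts`. -/
def HighestWeightClassLifts : Prop :=
  ∀ {σ : Type} [Fintype σ] [LinearOrder σ] (f : MvPolynomial σ ℂ) (m : ℕ) (χ : Weight σ),
    (highestWeightSpace (coordRep σ ℂ m) χ).map
        (Ideal.Quotient.mkₐ ℂ (orbitVanishingIdeal f m)).toLinearMap =
      highestWeightSpace (orbitCoordRep f m) χ

theorem highestWeightClassLifts_holds : HighestWeightClassLifts :=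
  fun f m χ => TriageR1K3.highestWeightClassLifts f m χ

/-- card semisimple-lift-exact-rank — Transfer `ExactRankFormula` (verbatim); PROVED above as
`TriageR1K3.range_hwToPoly_eq`. -/
def ExactRankFormula : Prop :=
  ∀ {σ : Type} [Fintype σ] [LinearOrder σ] (f : MvPolynomial σ ℂ) (m : ℕ) (χ : Weight σ),
    LinearMap.range (hwToPoly f m χ) =
      (highestWeightSpace (coordRep σ ℂ m) χ).map (genericOrbitMap f m).toLinearMap

theorem exactRankFormula_holds : ExactRankFormula :=
  fun f m χ => TriageR1K3.range_hwToPoly_eq f m χ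

/-- card hwtopoly-range-truncation — `BorelConjunct` (verbatim). -/
def BorelConjunct : Prop :=
  ∀ (m : ℕ) [NeZero m] (χ : Weight (MatIdx m))
    (x : ↥(highestWeightSpace (orbitCoordRep (detFormLex ℂ m) m) χ))
    (g : Matrix.GeneralLinearGroup (MatIdx m) ℂ), IsUpperTriangular g →
    MvPolynomial.aeval (R := ℂ)
        (fun p : MatIdx m × MatIdx m =>
          ∑ l : MatIdx m, ((g⁻¹ : Matrix.GeneralLinearGroup (MatIdx m) ℂ) :
            Matrix (MatIdx m) (MatIdx m) ℂ) p.1 l • MvPolynomial.X (l, p.2))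
        (hwToPoly (detFormLex ℂ m) m χ x) =
      weightChar χ g • hwToPoly (detFormLex ℂ m) m χ x

/-- … and it HOLDS (`hwToPoly_apply` + `borelClausePoly_holds`; `NeZero m` unused). -/
theorem borelConjunct_holds : BorelConjunct := by
  intro m _ χ x g hg
  rw [hwToPoly_apply]
  exact borelClausePoly_holds m χ x g hg

/-- card adapted-basis-one-psg — `DetOneParamDivisibility` (verbatim). -/
def DetOneParamDivisibility : Prop :=
  ∀ (m r : ℕ) (M₀ M₁ : Matrix (Fin m) (Fin m) ℂ), M₀.rank ≤ r → ∀ j < m - r,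
    (M₀.map (Polynomial.C : ℂ →+* Polynomial ℂ) +
        (Polynomial.X : Polynomial ℂ) • M₁.map (Polynomial.C : ℂ →+* Polynomial ℂ)).det.coeff j = 0

/-- card adapted-basis-one-psg — second rung `AdaptedDetTransverseOrder` (verbatim). -/
def AdaptedDetTransverseOrder : Prop :=
  ∀ (m r : ℕ) (K : Finset (MatIdx m)) (h : Matrix (MatIdx m) (MatIdx m) ℂ),
    (∀ v : MatIdx m → ℂ, (∀ p, p ∉ K → v p = 0) →
      (Matrix.of fun a b : Fin m => (Matrix.vecMul v h) (toLex (a, b))).rank ≤ r) →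
    ∀ e ∈ (linSubst (MatIdx m) ℂ h (detFormLex ℂ m)).support,
      m - r ≤ e.sum fun p n => if p ∈ K then 0 else n

/-- card projection-mixed-columns — `MixedColumnsVanish` (verbatim). -/
def MixedColumnsVanish : Prop :=
  ∀ (m r : ℕ) (S : Finset (Fin m)), r < S.card →
    ∀ (u w : Matrix (Fin m) (Fin m) ℂ), u.rank ≤ r →
      (Matrix.of fun a c => if c ∈ S then u a c else w a c).det = 0

/-- card projection-mixed-columns — `MixedColumnsVanishGeneric` (verbatim). -/
def MixedColumnsVanishGeneric : Prop :=
  ∀ (m r : ℕ) (U : Submodule ℂ (MatIdx m → ℂ)),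
    (∀ u ∈ U, (Matrix.of fun a b : Fin m => u (toLex (a, b))).rank ≤ r) →
    ∀ (π : (MatIdx m → ℂ) →ₗ[ℂ] (MatIdx m → ℂ)), (∀ v, π v ∈ U) →
    ∀ (S : Finset (Fin m)), r < S.card →
      (Matrix.of fun a c : Fin m =>
        if c ∈ S then
          ∑ j : MatIdx m, ∑ i : MatIdx m,
            (MvPolynomial.X (Sum.inl j) : MvPolynomial (MatIdx m ⊕ ((MatIdx m × MatIdx m) ⊕ (Fin m × Fin m))) ℂ) *
              MvPolynomial.X (Sum.inr (Sum.inl (j, i))) *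
              MvPolynomial.C (π (Pi.single i 1) (toLex (a, c)))
        else MvPolynomial.X (Sum.inr (Sum.inr (a, c)))).det = 0

/-- The two kernel-column / one-parameter first lemmas agree (same statement up to
`Polynomial.X_pow_dvd_iff`): evidence for the merge det-transversal-order-transport ≈
adapted-basis-one-psg at the level of their first rung. -/
theorem kernelColumnDivisibility_iff_detOneParamDivisibility :
    KernelColumnDivisibility ↔ DetOneParamDivisibility := by
  constructor
  · intro h m r M₀ M₁ hr j hj
    exact (Polynomial.X_pow_dvd_iff.mp (h m r M₀ M₁ hr)) j hj
  · intro h m r u y hr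
    exact Polynomial.X_pow_dvd_iff.mpr (h m r u y hr)

end FirstLemmas

/-! ## (4) Degenerate instances of the valuative first lemmas (r ≥ m: exponent 0) -/

example (m r : ℕ) (hr : m ≤ r) (u y : Matrix (Fin m) (Fin m) ℂ) :
    (Polynomial.X : Polynomial ℂ) ^ (m - r) ∣
      (u.map (Polynomial.C : ℂ →+* Polynomial ℂ) + (Polynomial.X : Polynomial ℂ) • y.map Polynomial.C).det := by
  rw [Nat.sub_eq_zero_of_le hr, pow_zero]
  exact one_dvd _


/-! ## (5) Row convention of the transport (card det-transversal-order-transport, falsifier (b);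
cdisprove's `coeffVanishingOrder_false_with_columns`) -/

/-- `linSubst A` sends the linear form `ℓ = Σ_i c_i x_i` to `Σ_j ℓ(row_j A) · x_j`, where
`row_j A = (i ↦ A j i)`: the transported generators are indexed by ROWS, matching
`L_U = {A : ∀ j, (i ↦ A (j, i)) ∈ U}` in the crux. -/
theorem linSubst_linearForm {m : ℕ} (A : Matrix (MatIdx m) (MatIdx m) ℂ) (c : MatIdx m → ℂ) :
    linSubst (MatIdx m) ℂ A (∑ i : MatIdx m, c i • X i) =
      ∑ j : MatIdx m, (∑ i : MatIdx m, c i * A j i) • (X j : MvPolynomial (MatIdx m) ℂ) := by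
  simp only [map_sum, map_smul, Literature.Computability.AlgebraicComplexity.linSubst_X,
    Finset.smul_sum, smul_smul, Finset.sum_smul]
  rw [Finset.sum_comm]


/-! ## (6) The common line end to end, conditional on the support item stmt-12628

`CoeffVanishingOrder → ValuativeBound`: lift (§3) + T1 (`degree_clause`) + T2 (generators-to-powers
below + stmt-12628) + T3 (`stab_clause_poly`) + T4 (`borel_clause_poly`) + glue. -/

/-- GeneratorsToPower (cards 3/4/5, T2 glue): an algebra hom sending every variable into an ideal
`J` sends a homogeneous polynomial of degree `δ` into `J ^ δ`. -/
theorem aeval_mem_pow_of_isHomogeneous {ι τ : Type*} (Φ : MvPolynomial ι ℂ →ₐ[ℂ] MvPolynomial τ ℂ)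
    (J : Ideal (MvPolynomial τ ℂ)) (hJ : ∀ d, Φ (X d) ∈ J) {F : MvPolynomial ι ℂ} {δ : ℕ}
    (hF : F.IsHomogeneous δ) : Φ F ∈ J ^ δ := by
  classical
  rw [F.as_sum, map_sum]
  refine Ideal.sum_mem _ fun s hs => ?_
  have hdeg : (∑ d ∈ s.support, s d) = δ := by
    have h := hF (mem_support_iff.mp hs)
    simpa [Finsupp.weight_apply, Finsupp.sum] using h
  rw [monomial_eq, map_mul]
  refine Ideal.mul_mem_left _ _ ?_
  rw [Finsupp.prod, map_prod, ← hdeg, ← Finset.prod_pow_eq_pow_sum]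
  refine Ideal.prod_mem_prod fun d _ => ?_
  rw [map_pow]
  exact Ideal.pow_mem_pow (hJ d) _

/-- **The crux modulo stmt-12628**: `CoeffVanishingOrder → ValuativeBound` (the line of cards
semisimple-lift-exact-rank / hwtopoly-*, re-derived independently in this seat). -/
theorem valuativeBound_of_coeffVanishingOrder
    (hC : Summit.ValiantsHypothesis.ValiantsHypothesis.Theses.ValuativeGCT.CoeffVanishingOrder) :
    Summit.ValiantsHypothesis.ValiantsHypothesis.Theses.ValuativeGCT.ValuativeBound := by
  apply valuativeBound_of_rangeLeTruncation
  intro m _ U r hU δ lam hlam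
  dsimp only
  rintro P ⟨x, rfl⟩
  -- lift the class `x` to an honest highest-weight vector `F`
  have hxmap : (x : OrbitCoordRing (detFormLex ℂ m) m) ∈
      (highestWeightSpace (coordRep (MatIdx m) ℂ m)
          ((Weight.dualOfPartition (m * m) lam).toMatIdx : Weight (MatIdx m))).map
        (Ideal.Quotient.mkₐ ℂ (orbitVanishingIdeal (detFormLex ℂ m) m)).toLinearMap := by
    rw [highestWeightClassLifts]; exact x.2
  obtain ⟨F, hF, hFx⟩ := hxmap
  have hFx' : Ideal.Quotient.mk (orbitVanishingIdeal (detFormLex ℂ m) m) F =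
      (x : OrbitCoordRing (detFormLex ℂ m) m) := hFx
  have hxF : Ideal.Quotient.mk (orbitVanishingIdeal (detFormLex ℂ m) m) F ∈
      highestWeightSpace (orbitCoordRep (detFormLex ℂ m) m)
        ((Weight.dualOfPartition (m * m) lam).toMatIdx : Weight (MatIdx m)) := by
    rw [hFx']; exact x.2
  have hP : hwToPoly (detFormLex ℂ m) m ((Weight.dualOfPartition (m * m) lam).toMatIdx : Weight (MatIdx m)) x =
      genericOrbitMap (detFormLex ℂ m) m F := by
    rw [hwToPoly_apply, ← hFx', orbitCoordToPoly_mk]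
  rw [hP]
  -- the four clauses
  have hT1 : genericOrbitMap (detFormLex ℂ m) m F ∈
      homogeneousSubmodule (MatIdx m × MatIdx m) ℂ (m * δ) := by
    have h := degree_clause lam hlam hxF
    rwa [orbitCoordToPoly_mk] at h
  have hJ : ∀ d : DegIdx (MatIdx m) m, genericOrbitMap (detFormLex ℂ m) m (X d) ∈
      (MvPolynomial.vanishingIdeal ℂ {p : MatIdx m × MatIdx m → ℂ | ∀ j : MatIdx m, (fun i => p (j, i)) ∈ U}) ^ (m - r) :=
    fun d => hC m U r hU d
  have hFhom : F.IsHomogeneous δ :=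
    isHomogeneous_of_mem_highestWeightSpace (NeZero.ne m) hF (size_toMatIdx_dualOfPartition m lam hlam)
  have hT2 : genericOrbitMap (detFormLex ℂ m) m F ∈
      (MvPolynomial.vanishingIdeal ℂ {p : MatIdx m × MatIdx m → ℂ | ∀ j : MatIdx m, (fun i => p (j, i)) ∈ U}) ^ (δ * (m - r)) := by
    have h := aeval_mem_pow_of_isHomogeneous (genericOrbitMap (detFormLex ℂ m) m) _ hJ hFhom
    rwa [← pow_mul, mul_comm] at h
  refine Submodule.mem_inf.mpr ⟨Submodule.mem_inf.mpr ⟨Submodule.mem_inf.mpr ⟨hT1, ?_⟩, ?_⟩, ?_⟩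
  · exact hT2
  · simp only [Submodule.mem_iInf, LinearMap.mem_ker, LinearMap.sub_apply, LinearMap.id_apply,
      AlgHom.toLinearMap_apply, sub_eq_zero]
    intro M hM
    exact stab_clause_poly F hM
  · simp only [Submodule.mem_iInf, LinearMap.mem_ker, LinearMap.sub_apply, LinearMap.smul_apply,
      LinearMap.id_apply, AlgHom.toLinearMap_apply, sub_eq_zero]
    intro g hg
    have h := borel_clause_poly hxF hg
    rwa [orbitCoordToPoly_mk] at h

end

end TriageR1K3
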